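import Summits.QuantumFields.BalabanUV.Beta.GAN24.BackgroundExpansionTaylor

/-!
# `BalabanUV.Beta.GAN24.ResolventCurveTaylor` — binder row G-an2-4 ∕ (CONV-C), route R7 «TWO CURRENCIES», PART 240: FAÀ DI BRUNO FOR THE INVERSE OF A RESOLVENT READ-OUT ALONG A
# CURVE — for ANY square complex matrix `D`, ANY REAL `C^∞` curve of perturbations `s ↦ P(s)` (given as its jet tower `P_j = ∂^j_sP`, `∂_sP_j = P_{j+1}`), ANY continuous linear read-out `Φ`:
# `R(s) = (D + P(s))⁻¹` has `R′ = −R·P₁·R`, every WORD `R·P_{j₁}·R·P_{j₂}⋯R` differentiates into a `ℤ`-combination of words (insert the letter `1`, or raise one letter), hence for every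
# order `N` there is ONE finite `ℤ`-combination of DIAGRAMS (products of the letters `(ΦR)⁻¹` and `Φ(word)`), THE SAME FOR ALL `(D, P, Φ, s)` and with every word letter `≤ N`, equal to
# `∂^N_s[(Φ R(s))⁻¹]` wherever `D + P(s)` and `Φ(R(s))` are invertible.  PART 161 is the LINE `P(s) = sP` over `ℂ` (`P₁ = P`, `P_j = 0` for `j ≥ 2`: the words collapse to the chains
# `R(PR)^j`); here the curve is REAL (`s : ℝ`) because a background of transporters `U_s` enters the covariant Laplacian through `U_s` AND `U_s*` — real-analytic, not holomorphic, in the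
# natural parameters (PART 241 reads the exact abelian covariant Laplacian along transporter curves on it) (unit b2b-balaban-gan24-p3, gen 65; v1)

NOT IN PRINT; OUR PROOF ([folklore] matrix calculus over `ℝ` on the complete normed algebra `Matrix m m ℂ` with the scoped `ℓ²`-operator norm (`NormedAlgebra.complexToReal`): Mathlib's
`hasFDerivAt_ringInverse`, `HasDerivAt.mul`, `ContinuousLinearMap.hasFDerivAt.comp_hasDerivAt` (through `Φ.restrictScalars ℝ`), `HasDerivAt.fun_sum ∕ fun_const_smul`, `iteratedDeriv_succ`,
`Filter.EventuallyEq.deriv_eq`, `ContDiff.differentiable_iteratedDeriv`; the pattern of PART 161 §1–§2; nothing printed is a hypothesis).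
HONEST FRAMING (cell contract, verbatim): «discharging `BetaPertH` makes Bałaban's UV stability UNCONDITIONAL — a real constructive-QFT result; it is NOT the
continuum limit and NOT the Clay problem.»  HONEST DEPENDENCY (verbatim): «continuum YM on T⁴ ⇐ BetaPertH ∧ nine spine estimates (0/9 proved); BetaPertH ⇐
(D1) ∧ (D4) ∧ CAP+tail; G-an2-4 gates asym, D1 and NE2/3/4.»

WHAT THIS FILE PROVES (0 sorry, 0 `def`; GENERIC: `m, n` finite types, `D : Matrix m m ℂ`, a jet tower `Pd : ℕ → ℝ → Matrix m m ℂ` with `HasDerivAt (Pd j) (Pd (j+1) s) s` for all `j, s`,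
`Φ : Matrix m m ℂ →L[ℂ] Matrix n n ℂ`, `R(s) = (D + Pd 0 s)⁻¹`; the WORD of `w = [j₁,…,j_n]` at `s` is `foldr (fun j N ↦ R(s)·Pd j s·N) R(s) w = R·P_{j₁}·R⋯P_{j_n}·R`; the LETTER of
`o : Option (List ℕ)` is `o.elim (ΦR(s))⁻¹ (w ↦ Φ(word w s))`; the DIAGRAM of `ℓ : List (Option (List ℕ))` is `(ℓ.map letter).prod`):
* §1 `hasDerivAt_nonsing_inv_real` (`(A⁻¹)′ = −A⁻¹A′A⁻¹` over `ℝ`), `hasDerivAt_resolventCurve` (`R′ = −R·P₁·R`), **`hasDerivAt_curveWord`** (every word: `∃` a finite `ℤ`-combination of words,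
  uniform in the data, that is its derivative, with letters `≤ max(old letters) + 1` — precisely: in the words `1 :: w`-insertions and one-letter raisings), `hasDerivAt_curveLetter_some`,
  `hasDerivAt_curveLetter_none` (`((ΦR)⁻¹)′ = (ΦR)⁻¹Φ(R·P₁·R)(ΦR)⁻¹`), `isOpen_resolventCurveSet`.
* §2 **`hasDerivAt_curveDiagram`**, **`iteratedDeriv_inv_eq_curveDiagramSum`** (every `N`: `∃ (J, z, ℓ)` finite, uniform in `(D, Pd, Φ, s)`, ALL WORD LETTERS `≤ N` (and `N = 0`: the single
  diagram `[none]`), with `∂^N_s[(ΦR(s))⁻¹] = Σ_{i ∈ J} z_i • diagram(ℓ_i)(s)` at every good `s`).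
* §3 `hasDerivAt_iteratedDeriv_of_contDiff` (a `C^∞` curve `P : ℝ → Matrix m m ℂ` gives the jet tower `Pd j = iteratedDeriv j P`), **`iteratedDeriv_inv_eq_curveDiagramSum_of_contDiff`**.
WHAT IT DOES NOT DO: the END (PART 241 reads the exact abelian covariant Laplacian along transporter curves); several parameters (mixed partials = polarisation of one-parameter curves).
SUPPLIER work; NEVER «G-an2-4 closed»; NOT (CONV-C), NOT D1, NOT `BetaPertH`, NOT continuum, NOT Clay.  Records: `HOME/b2b-balaban-gan24-p3/gen65/README.md`.
-/

noncomputable section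

open scoped BigOperators ComplexConjugate Matrix Matrix.Norms.L2Operator
open Filter Topology

namespace Summit.QuantumFields.BalabanUV.Beta.GAN24.ResolventCurveTaylor

/-! ## §1 Real curves of complex matrices: the resolvent along a curve, its words, the two letters -/

section Calculus

variable {m n : Type*} [Fintype m] [DecidableEq m] [Fintype n] [DecidableEq n]

/-- **`(A⁻¹)′ = −A⁻¹·A′·A⁻¹`** along a REAL curve of complex matrices at a point where `det A` is a unit (Mathlib's `hasFDerivAt_ringInverse` over `ℝ` on the complete normed algebra
`Matrix n n ℂ` with the `ℓ²`-operator norm, `NormedAlgebra.complexToReal`; PART 161's `hasDerivAt_nonsing_inv` is the complex line). [folklore] -/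
theorem hasDerivAt_nonsing_inv_real {A : ℝ → Matrix n n ℂ} {A' : Matrix n n ℂ} {s : ℝ} (h : HasDerivAt A A' s) (hdet : IsUnit (A s).det) :
    HasDerivAt (fun v => (A v)⁻¹) (-((A s)⁻¹ * A' * (A s)⁻¹)) s := by
  haveI : CompleteSpace (Matrix n n ℂ) := FiniteDimensional.complete ℂ (Matrix n n ℂ)
  obtain ⟨w, hw⟩ := (Matrix.isUnit_iff_isUnit_det _).2 hdet
  have key := hasFDerivAt_ringInverse (𝕜 := ℝ) w
  rw [hw] at key
  have h2 := key.comp_hasDerivAt s h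
  simp only [neg_apply, ContinuousLinearMap.mulLeftRight_apply] at h2
  have hinv : ((w⁻¹ : (Matrix n n ℂ)ˣ) : Matrix n n ℂ) = (A s)⁻¹ := by
    rw [Matrix.coe_units_inv, hw]
  rw [hinv] at h2
  refine h2.congr_of_eventuallyEq (Eventually.of_forall fun v => ?_)
  exact Matrix.nonsing_inv_eq_ringInverse (A v)

/-- **`R′ = −R·P₁·R`** for the resolvent `R(s) = (D + P(s))⁻¹ along the curve (jet tower `∂_sP_j = P_{j+1}`), at a point where `D + P(s)` is invertible. [folklore] -/
theorem hasDerivAt_resolventCurve (D : Matrix m m ℂ) {Pd : ℕ → ℝ → Matrix m m ℂ} (hPd : ∀ j v, HasDerivAt (Pd j) (Pd (j + 1) v) v) {s : ℝ}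
    (hs : IsUnit (D + Pd 0 s).det) :
    HasDerivAt (fun v : ℝ => (D + Pd 0 v)⁻¹) (-((D + Pd 0 s)⁻¹ * Pd 1 s * (D + Pd 0 s)⁻¹)) s :=
  hasDerivAt_nonsing_inv_real ((hPd 0 s).const_add D) hs

/-- **`hasDerivAt_curveWord` — THE DERIVATIVE OF EVERY WORD IS A FINITE `ℤ`-COMBINATION OF WORDS, UNIFORMLY IN THE DATA** [our proof]: for every `w : List ℕ` there are a finite index type `J`,
integers `z_i` and words `w_i` — each either `w` with the letter `1` inserted, or `w` with ONE letter raised by one — such that for ALL `(D, Pd, s)` with `D + P(s)` invertible,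
`d∕ds (R·P_{j₁}·R⋯P_{j_n}·R) = Σ_i z_i • word(w_i)` (`R′ = −R·P₁·R`, `P_j′ = P_{j+1}`, product rule along the list). -/
theorem hasDerivAt_curveWord (w : List ℕ) :
    ∃ (J : Type) (_ : Fintype J) (z : J → ℤ) (w' : J → List ℕ), (∀ i, ∀ j ∈ w' i, j = 1 ∨ j ∈ w ∨ j - 1 ∈ w) ∧
      ∀ {m : Type} [Fintype m] [DecidableEq m] (D : Matrix m m ℂ) (Pd : ℕ → ℝ → Matrix m m ℂ) (s : ℝ),
        (∀ j v, HasDerivAt (Pd j) (Pd (j + 1) v) v) → IsUnit (D + Pd 0 s).det →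
        HasDerivAt (fun v : ℝ => List.foldr (fun j N => (D + Pd 0 v)⁻¹ * Pd j v * N) (D + Pd 0 v)⁻¹ w)
          (∑ i : J, (z i : ℂ) • List.foldr (fun j N => (D + Pd 0 s)⁻¹ * Pd j s * N) (D + Pd 0 s)⁻¹ (w' i)) s := by
  induction w with
  | nil =>
    refine ⟨Unit, inferInstance, fun _ => -1, fun _ => [1], fun _ j hj => Or.inl (by simpa using hj), ?_⟩
    intro m _ _ D Pd s hPd hs
    simp only [List.foldr_nil, Finset.univ_unique, Finset.sum_singleton, Int.cast_neg, Int.cast_one, neg_smul, one_smul, List.foldr_cons, Matrix.mul_assoc]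
    have h := hasDerivAt_nonsing_inv_real ((hPd 0 s).const_add D) hs
    simpa only [Matrix.mul_assoc] using h
  | cons j w ih =>
    obtain ⟨J, hJ, z, w', hw', h⟩ := ih
    refine ⟨Option (Option J), inferInstance, fun i => i.elim (-1) (fun i' => i'.elim 1 z),
      fun i => i.elim (1 :: j :: w) (fun i' => i'.elim ((j + 1) :: w) (fun i'' => j :: w' i'')), ?_, ?_⟩
    · rintro (_ | _ | i'') j' hj'
      · simp only [Option.elim, List.mem_cons] at hj'
        rcases hj' with rfl | rfl | h3
        · exact Or.inl rfl
        · exact Or.inr (Or.inl (List.mem_cons_self))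
        · exact Or.inr (Or.inl (List.mem_cons_of_mem _ h3))
      · simp only [Option.elim, List.mem_cons] at hj'
        rcases hj' with rfl | h3
        · exact Or.inr (Or.inr (by simp))
        · exact Or.inr (Or.inl (List.mem_cons_of_mem _ h3))
      · simp only [Option.elim, List.mem_cons] at hj'
        rcases hj' with rfl | h3
        · exact Or.inr (Or.inl (List.mem_cons_self))
        · rcases hw' i'' j' h3 with h4 | h4 | h4
          · exact Or.inl h4
          · exact Or.inr (Or.inl (List.mem_cons_of_mem _ h4))
          · exact Or.inr (Or.inr (List.mem_cons_of_mem _ h4))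
    · intro m _ _ D Pd s hPd hs
      have hRd : HasDerivAt (fun v : ℝ => (D + Pd 0 v)⁻¹) (-((D + Pd 0 s)⁻¹ * Pd 1 s * (D + Pd 0 s)⁻¹)) s :=
        hasDerivAt_nonsing_inv_real ((hPd 0 s).const_add D) hs
      have hT := h D Pd s hPd hs
      have hprod := (hRd.fun_mul (hPd j s)).fun_mul hT
      simp only [List.foldr_cons]
      refine hprod.congr_deriv ?_
      rw [Fintype.sum_option, Fintype.sum_option]
      simp only [Option.elim, Int.cast_neg, Int.cast_one, neg_smul, one_smul, List.foldr_cons, Finset.mul_sum, Matrix.mul_smul, Matrix.add_mul, Matrix.neg_mul,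
        Matrix.mul_assoc]
      abel

/-- the read-out of a differentiable curve: `(Φ ∘ X)′ = Φ(X′)` (`Φ` is `ℂ`-linear, read `ℝ`-linearly). [folklore] -/
theorem hasDerivAt_readout (Φ : Matrix m m ℂ →L[ℂ] Matrix n n ℂ) {X : ℝ → Matrix m m ℂ} {X' : Matrix m m ℂ} {s : ℝ} (h : HasDerivAt X X' s) :
    HasDerivAt (fun v => Φ (X v)) (Φ X') s :=
  ((Φ.restrictScalars ℝ).hasFDerivAt).comp_hasDerivAt s h

/-- the letter `s ↦ (ΦR(s))⁻¹`: derivative `(ΦR)⁻¹·Φ(R·P₁·R)·(ΦR)⁻¹` (`= c⁻¹ċc⁻¹` with `ċ = −Φ(RP₁R)`). [folklore] -/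
theorem hasDerivAt_curveLetter_none (D : Matrix m m ℂ) (Φ : Matrix m m ℂ →L[ℂ] Matrix n n ℂ) {Pd : ℕ → ℝ → Matrix m m ℂ} (hPd : ∀ j v, HasDerivAt (Pd j) (Pd (j + 1) v) v)
    {s : ℝ} (hs : IsUnit (D + Pd 0 s).det) (hc : IsUnit (Φ (D + Pd 0 s)⁻¹).det) :
    HasDerivAt (fun v : ℝ => (Φ (D + Pd 0 v)⁻¹)⁻¹)
      ((Φ (D + Pd 0 s)⁻¹)⁻¹ * Φ (List.foldr (fun j N => (D + Pd 0 s)⁻¹ * Pd j s * N) (D + Pd 0 s)⁻¹ [1]) * (Φ (D + Pd 0 s)⁻¹)⁻¹) s := by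
  have h1 : HasDerivAt (fun v : ℝ => Φ (D + Pd 0 v)⁻¹) (Φ (-((D + Pd 0 s)⁻¹ * Pd 1 s * (D + Pd 0 s)⁻¹))) s :=
    hasDerivAt_readout Φ (hasDerivAt_resolventCurve D hPd hs)
  have h2 := hasDerivAt_nonsing_inv_real h1 hc
  refine h2.congr_deriv ?_
  rw [map_neg, Matrix.mul_neg, Matrix.neg_mul, neg_neg, List.foldr_cons, List.foldr_nil]

omit [DecidableEq n] in
/-- continuity ⟹ the set of GOOD parameters `{s | det(D + P(s)) ≠ 0 ∧ det Φ(R(s)) ≠ 0}` is open. [folklore] -/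
theorem isOpen_resolventCurveSet [DecidableEq n] (D : Matrix m m ℂ) (Φ : Matrix m m ℂ →L[ℂ] Matrix n n ℂ) {Pd : ℕ → ℝ → Matrix m m ℂ}
    (hPd : ∀ j v, HasDerivAt (Pd j) (Pd (j + 1) v) v) :
    IsOpen {s : ℝ | IsUnit (D + Pd 0 s).det ∧ IsUnit (Φ (D + Pd 0 s)⁻¹).det} := by
  rw [isOpen_iff_mem_nhds]
  rintro s ⟨hs, hc⟩
  have h1 : ∀ᶠ v in 𝓝 s, IsUnit (D + Pd 0 v).det := by
    have hcont : Continuous fun v : ℝ => (D + Pd 0 v).det :=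
      (continuous_const.add (continuous_iff_continuousAt.mpr fun v => (hPd 0 v).continuousAt)).matrix_det
    exact (hcont.continuousAt.eventually_ne hs.ne_zero).mono fun v hv => isUnit_iff_ne_zero.mpr hv
  have h2 : ∀ᶠ v in 𝓝 s, IsUnit (Φ (D + Pd 0 v)⁻¹).det := by
    have hcont : ContinuousAt (fun v : ℝ => (Φ (D + Pd 0 v)⁻¹).det) s :=
      (continuous_id.matrix_det.continuousAt).comp (hasDerivAt_readout Φ (hasDerivAt_resolventCurve D hPd hs)).continuousAt
    exact (hcont.eventually_ne hc.ne_zero).mono fun v hv => isUnit_iff_ne_zero.mpr hv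
  exact h1.and h2

end Calculus

/-! ## §2 The derivative of a diagram is a finite `ℤ`-combination of diagrams; all iterated derivatives of `(ΦR)⁻¹` along the curve -/

section Diagrams

/-- **`hasDerivAt_curveDiagram` — THE DERIVATIVE OF EVERY DIAGRAM IS A FINITE `ℤ`-COMBINATION OF DIAGRAMS, UNIFORMLY IN THE DATA** [our proof]: for every `ℓ : List (Option (List ℕ))` there
are `(J, z, ℓ′)` finite such that for ALL `(D, Pd, Φ, s)` (jet tower, `D + P(s)` and `Φ(R(s))` invertible), `d∕ds Π_{o ∈ ℓ} letter_o(s) = Σ_i z_i • Π_{o ∈ ℓ′_i} letter_o(s)`; every word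
letter of `ℓ′` is `1`, a word letter of `ℓ`, or a word letter of `ℓ` raised by one. -/
theorem hasDerivAt_curveDiagram (ℓ : List (Option (List ℕ))) :
    ∃ (J : Type) (_ : Fintype J) (z : J → ℤ) (ℓ' : J → List (Option (List ℕ))),
      (∀ i w', some w' ∈ ℓ' i → ∀ j ∈ w', j = 1 ∨ ∃ w, some w ∈ ℓ ∧ (j ∈ w ∨ j - 1 ∈ w)) ∧
      ∀ {m n : Type} [Fintype m] [DecidableEq m] [Fintype n] [DecidableEq n]
        (D : Matrix m m ℂ) (Pd : ℕ → ℝ → Matrix m m ℂ) (Φ : Matrix m m ℂ →L[ℂ] Matrix n n ℂ) (s : ℝ),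
        (∀ j v, HasDerivAt (Pd j) (Pd (j + 1) v) v) → IsUnit (D + Pd 0 s).det → IsUnit (Φ (D + Pd 0 s)⁻¹).det →
        HasDerivAt (fun v : ℝ => (ℓ.map fun o : Option (List ℕ) => o.elim (Φ (D + Pd 0 v)⁻¹)⁻¹
            (fun w => Φ (List.foldr (fun j N => (D + Pd 0 v)⁻¹ * Pd j v * N) (D + Pd 0 v)⁻¹ w))).prod)
          (∑ i : J, (z i : ℂ) • ((ℓ' i).map fun o : Option (List ℕ) => o.elim (Φ (D + Pd 0 s)⁻¹)⁻¹
            (fun w => Φ (List.foldr (fun j N => (D + Pd 0 s)⁻¹ * Pd j s * N) (D + Pd 0 s)⁻¹ w))).prod) s := by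
  induction ℓ with
  | nil =>
    refine ⟨Fin 0, inferInstance, Fin.elim0, Fin.elim0, fun i => Fin.elim0 i, ?_⟩
    intro m n _ _ _ _ D Pd Φ s hPd hs hc
    simp only [List.map_nil, List.prod_nil, Finset.univ_eq_empty, Finset.sum_empty]
    exact hasDerivAt_const s 1
  | cons o ℓ ih =>
    obtain ⟨J, hJ, z, ℓ', hℓ', h⟩ := ih
    cases o with
    | none =>
      refine ⟨Option J, inferInstance, fun i => i.elim 1 z, fun i => i.elim ([none, some [1], none] ++ ℓ) (fun i' => none :: ℓ' i'), ?_, ?_⟩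
      · rintro (_ | i') w' hw' j hj
        · simp only [Option.elim, List.cons_append, List.nil_append, List.mem_cons, reduceCtorEq, Option.some.injEq, false_or] at hw'
          rcases hw' with rfl | hw'
          · exact Or.inl (by simpa using hj)
          · exact Or.inr ⟨w', List.mem_cons_of_mem _ hw', Or.inl hj⟩
        · simp only [Option.elim, List.mem_cons, reduceCtorEq, false_or] at hw'
          rcases hℓ' i' w' hw' j hj with h1 | ⟨w, hw, hjw⟩
          · exact Or.inl h1
          · exact Or.inr ⟨w, List.mem_cons_of_mem _ hw, hjw⟩
      · intro m n _ _ _ _ D Pd Φ s hPd hs hc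
        have hd := (hasDerivAt_curveLetter_none D Φ hPd hs hc).mul (h D Pd Φ s hPd hs hc)
        simp only [List.map_cons, List.prod_cons]
        refine hd.congr_deriv ?_
        rw [Fintype.sum_option]
        simp only [Option.elim, Int.cast_one, one_smul, List.map_append, List.prod_append, List.map_cons, List.prod_cons, List.map_nil, List.prod_nil,
          Matrix.mul_one, Finset.mul_sum, Matrix.mul_smul, Matrix.mul_assoc]
    | some w =>
      obtain ⟨Jw, hJw, zw, w', hw', hw⟩ := hasDerivAt_curveWord w
      refine ⟨Jw ⊕ J, inferInstance, fun i => i.elim zw z, fun i => i.elim (fun a => some (w' a) :: ℓ) (fun i' => some w :: ℓ' i'), ?_, ?_⟩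
      · rintro (a | i') w'' hw'' j hj
        · simp only [Sum.elim_inl, List.mem_cons, Option.some.injEq] at hw''
          rcases hw'' with rfl | hw''
          · rcases hw' a j hj with h1 | h1 | h1
            · exact Or.inl h1
            · exact Or.inr ⟨w, List.mem_cons_self, Or.inl h1⟩
            · exact Or.inr ⟨w, List.mem_cons_self, Or.inr h1⟩
          · exact Or.inr ⟨w'', List.mem_cons_of_mem _ hw'', Or.inl hj⟩
        · simp only [Sum.elim_inr, List.mem_cons, Option.some.injEq] at hw''
          rcases hw'' with rfl | hw''
          · exact Or.inr ⟨w'', List.mem_cons_self, Or.inl hj⟩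
          · rcases hℓ' i' w'' hw'' j hj with h1 | ⟨w₀, hw₀, hjw⟩
            · exact Or.inl h1
            · exact Or.inr ⟨w₀, List.mem_cons_of_mem _ hw₀, hjw⟩
      · intro m n _ _ _ _ D Pd Φ s hPd hs hc
        have hwd := hasDerivAt_readout Φ (hw D Pd s hPd hs)
        have hd := hwd.mul (h D Pd Φ s hPd hs hc)
        simp only [List.map_cons, List.prod_cons]
        refine hd.congr_deriv ?_
        rw [Fintype.sum_sum_type]
        simp only [Sum.elim_inl, Sum.elim_inr, List.map_cons, List.prod_cons, Option.elim, map_sum, map_smul, Finset.sum_mul, Finset.mul_sum,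
          Matrix.smul_mul, Matrix.mul_smul]

/-- **`iteratedDeriv_inv_eq_curveDiagramSum` — FAÀ DI BRUNO FOR THE INVERSE OF A RESOLVENT READ-OUT ALONG A REAL CURVE, ALL ORDERS, UNIFORMLY, WITH THE LETTER BOUND** [our proof]: for every
`N` there are `(J, z, ℓ)` finite, EVERY WORD LETTER `≤ N` (and `≥ 1`), such that for ALL `(D, Pd, Φ, s)` (jet tower `∂_sP_j = P_{j+1}`, `D + P(s)` and `Φ(R(s))` invertible),
`∂^N_s[(Φ(D + P(s))⁻¹)⁻¹] = Σ_{i ∈ J} z_i • Π_{o ∈ ℓ_i} letter_o(s)`.  Induction on `N` (the good set is open: `isOpen_resolventCurveSet`; `Filter.EventuallyEq.deriv_eq`; `hasDerivAt_curveDiagram`). -/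
theorem iteratedDeriv_inv_eq_curveDiagramSum (N : ℕ) :
    ∃ (J : Type) (_ : Fintype J) (z : J → ℤ) (ℓ : J → List (Option (List ℕ))),
      (∀ i w, some w ∈ ℓ i → ∀ j ∈ w, 1 ≤ j ∧ j ≤ N) ∧
      ∀ {m n : Type} [Fintype m] [DecidableEq m] [Fintype n] [DecidableEq n]
        (D : Matrix m m ℂ) (Pd : ℕ → ℝ → Matrix m m ℂ) (Φ : Matrix m m ℂ →L[ℂ] Matrix n n ℂ) (s : ℝ),
        (∀ j v, HasDerivAt (Pd j) (Pd (j + 1) v) v) → IsUnit (D + Pd 0 s).det → IsUnit (Φ (D + Pd 0 s)⁻¹).det →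
        iteratedDeriv N (fun v : ℝ => (Φ (D + Pd 0 v)⁻¹)⁻¹) s
          = ∑ i : J, (z i : ℂ) • ((ℓ i).map fun o : Option (List ℕ) => o.elim (Φ (D + Pd 0 s)⁻¹)⁻¹
              (fun w => Φ (List.foldr (fun j N => (D + Pd 0 s)⁻¹ * Pd j s * N) (D + Pd 0 s)⁻¹ w))).prod := by
  induction N with
  | zero =>
    refine ⟨Unit, inferInstance, fun _ => 1, fun _ => [none], fun _ w hw => by simp at hw, ?_⟩
    intro m n _ _ _ _ D Pd Φ s hPd hs hc
    simp only [iteratedDeriv_zero, Finset.univ_unique, Finset.sum_singleton, Int.cast_one, one_smul, List.map_cons, List.map_nil, List.prod_cons, List.prod_nil,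
      Option.elim, Matrix.mul_one]
  | succ N ih =>
    obtain ⟨J, hJ, z, ℓ, hℓ, hN⟩ := ih
    choose Jf Ff zf ℓf hbf hf using fun i : J => hasDerivAt_curveDiagram (ℓ i)
    letI : ∀ i, Fintype (Jf i) := Ff
    refine ⟨(i : J) × Jf i, inferInstance, fun p => z p.1 * zf p.1 p.2, fun p => ℓf p.1 p.2, ?_, ?_⟩
    · rintro ⟨i, i'⟩ w hw j hj
      rcases hbf i i' w hw j hj with rfl | ⟨w₀, hw₀, hj₀ | hj₀⟩
      · exact ⟨le_rfl, Nat.succ_le_succ (Nat.zero_le _)⟩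
      · obtain ⟨h1, h2⟩ := hℓ i w₀ hw₀ j hj₀
        exact ⟨h1, h2.trans (Nat.le_succ _)⟩
      · obtain ⟨h1, h2⟩ := hℓ i w₀ hw₀ (j - 1) hj₀
        exact ⟨by omega, by omega⟩
    · intro m n _ _ _ _ D Pd Φ s hPd hs hc
      have hopen := isOpen_resolventCurveSet D Φ hPd
      have hnhds : ∀ᶠ v in 𝓝 s, iteratedDeriv N (fun v : ℝ => (Φ (D + Pd 0 v)⁻¹)⁻¹) v
          = ∑ i : J, (z i : ℂ) • ((ℓ i).map fun o : Option (List ℕ) => o.elim (Φ (D + Pd 0 v)⁻¹)⁻¹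
              (fun w => Φ (List.foldr (fun j N => (D + Pd 0 v)⁻¹ * Pd j v * N) (D + Pd 0 v)⁻¹ w))).prod :=
        Filter.eventually_of_mem (hopen.mem_nhds ⟨hs, hc⟩) fun v hv => hN D Pd Φ v hPd hv.1 hv.2
      rw [iteratedDeriv_succ, Filter.EventuallyEq.deriv_eq hnhds]
      have hder : HasDerivAt (fun v : ℝ => ∑ i : J, (z i : ℂ) • ((ℓ i).map fun o : Option (List ℕ) => o.elim (Φ (D + Pd 0 v)⁻¹)⁻¹
            (fun w => Φ (List.foldr (fun j N => (D + Pd 0 v)⁻¹ * Pd j v * N) (D + Pd 0 v)⁻¹ w))).prod)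
          (∑ i : J, (z i : ℂ) • ∑ i' : Jf i, (zf i i' : ℂ) • ((ℓf i i').map fun o : Option (List ℕ) => o.elim (Φ (D + Pd 0 s)⁻¹)⁻¹
            (fun w => Φ (List.foldr (fun j N => (D + Pd 0 s)⁻¹ * Pd j s * N) (D + Pd 0 s)⁻¹ w))).prod) s :=
        HasDerivAt.fun_sum fun i _ => (hf i D Pd Φ s hPd hs hc).fun_const_smul (z i : ℂ)
      rw [hder.deriv, Fintype.sum_sigma]
      refine Finset.sum_congr rfl fun i _ => ?_
      rw [Finset.smul_sum]
      refine Finset.sum_congr rfl fun i' _ => ?_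
      rw [smul_smul, Int.cast_mul]

end Diagrams

/-! ## §3 `C^∞` curves: the jet tower of iterated derivatives -/

section Smooth

variable {m n : Type*} [Fintype m] [DecidableEq m] [Fintype n] [DecidableEq n]

/-- a `C^∞` real curve of complex matrices has the jet tower `Pd j = iteratedDeriv j P`: `∂_s(iteratedDeriv j P) = iteratedDeriv (j+1) P`. [folklore] -/
theorem hasDerivAt_iteratedDeriv_of_contDiff {P : ℝ → Matrix m m ℂ} (hP : ∀ N : ℕ, ContDiff ℝ N P) (j : ℕ) (v : ℝ) :
    HasDerivAt (iteratedDeriv j P) (iteratedDeriv (j + 1) P v) v := by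
  have hdiff : Differentiable ℝ (iteratedDeriv j P) :=
    ContDiff.differentiable_iteratedDeriv j (hP (j + 1)) (by exact_mod_cast Nat.lt_succ_self j)
  rw [iteratedDeriv_succ]
  exact (hdiff v).hasDerivAt

/-- **`iteratedDeriv_inv_eq_curveDiagramSum_of_contDiff`** — §2 for a `C^∞` curve `P : ℝ → Matrix m m ℂ` (letters `iteratedDeriv j P s`, `R(s) = (D + P(s))⁻¹`). [our proof] -/
theorem iteratedDeriv_inv_eq_curveDiagramSum_of_contDiff (N : ℕ) :
    ∃ (J : Type) (_ : Fintype J) (z : J → ℤ) (ℓ : J → List (Option (List ℕ))),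
      (∀ i w, some w ∈ ℓ i → ∀ j ∈ w, 1 ≤ j ∧ j ≤ N) ∧
      ∀ {m n : Type} [Fintype m] [DecidableEq m] [Fintype n] [DecidableEq n]
        (D : Matrix m m ℂ) (P : ℝ → Matrix m m ℂ) (Φ : Matrix m m ℂ →L[ℂ] Matrix n n ℂ) (s : ℝ),
        (∀ N : ℕ, ContDiff ℝ N P) → IsUnit (D + P s).det → IsUnit (Φ (D + P s)⁻¹).det →
        iteratedDeriv N (fun v : ℝ => (Φ (D + P v)⁻¹)⁻¹) s
          = ∑ i : J, (z i : ℂ) • ((ℓ i).map fun o : Option (List ℕ) => o.elim (Φ (D + P s)⁻¹)⁻¹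
              (fun w => Φ (List.foldr (fun j N => (D + P s)⁻¹ * iteratedDeriv j P s * N) (D + P s)⁻¹ w))).prod := by
  obtain ⟨J, hJ, z, ℓ, hℓ, h⟩ := iteratedDeriv_inv_eq_curveDiagramSum N
  refine ⟨J, hJ, z, ℓ, hℓ, ?_⟩
  intro m n _ _ _ _ D P Φ s hP hs hc
  have h' := h D (fun j => iteratedDeriv j P) Φ s (hasDerivAt_iteratedDeriv_of_contDiff hP) (by simpa using hs) (by simpa using hc)
  simpa only [iteratedDeriv_zero] using h'

end Smooth

end Summit.QuantumFields.BalabanUV.Beta.GAN24.ResolventCurveTaylor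

end
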